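import Summits.NavierStokesRegularity.NavierStokesRegularity.Theorems.EfficiencyFloorRigidExitReferenceFlowContinuity
import HarnessLib

/-!
# Route `EfficiencyFloor`, support `RigidExit` (stmt-NavierStokesRegularity-25513) on the `ProductionEfficiencyDecay`
# ladder (stmt-NavierStokesRegularity-22866): THE REFERENCE FLOW attains its datum STRONGLY in `Ḣ¹`

Helper file (`--supports stmt-NavierStokesRegularity-22866`; line `efficiency_floor`), continuing
`…EfficiencyFloorRigidExitReferenceFlow` (p839713) and `…Continuity` (p839755). To run the tree's `H¹` robustness-of-regularity
estimate (`Literature.Analysis.FluidPDE.classicalNS_robustness_of_regularity_R3`, RRS 2016 Thm 9.1, a priori form — the census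
item (ii-b′) «Ḣ¹-stability of strong solutions», which IS in the tree) between a near-maximiser slice flow and the reference flow
`v` through the maximiser `m`, one works on `[δ, η·W]` (where both are classical with bounded Sobolev norms) and lets `δ → 0⁺`;
this needs the `Ḣ¹` DISTANCE `∫|curl (v(δ) − m)|²` to vanish as `δ → 0⁺`, not only the enstrophy `Z(v(δ)) → Z(m)` of p839755.
This file proves it:

* `integral_inner_curl_curl_eq` — `∫⟪curl w, curl m⟫ = ∫⟪w, curl curl m⟫` for admissible `m` and a `C^∞` field `w` with
  `D⁰w, D¹w ∈ L²` (self-adjointness of the curl on integrable pairs);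
* `tendsto_integral_inner_curl_nhdsGT` — along the reference flow, `∫⟪curl v(t), curl m⟫ → Z(m)` as `t → 0⁺` (WEAK `L²`
  continuity of Leray–Hopf solutions at `0⁺`, tested against `curl curl m = −Δm ∈ L²`);
* `tendsto_enstrophy_sub_nhdsGT` — **`∫|curl (v(t) − m)|² → 0` as `t → 0⁺`**: expand the square; `Z(v t) → Z(m)` (p839755)
  and the cross term `→ Z(m)`. (Norm convergence + weak convergence ⟹ strong convergence, done by hand in `Ḣ¹`.)

HONEST FRAMING: classical bookkeeping on the reference flow; `RigidExit`, `NearMaximiserBoundedAmplification`,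
`LerayFloorGap`, `ProductionEfficiencyDecay` (stmt-22866) and Navier–Stokes regularity stay OPEN; no summit statement is
proved. [folklore]
-/

-- the problem directory repeats the summit name (`NavierStokesRegularity/NavierStokesRegularity`)
set_option linter.dupNamespace false

noncomputable section

open Set Filter MeasureTheory Topology Function
open scoped InnerProductSpace RealInnerProductSpace ENNReal NNReal ContDiff Laplacian
open Literature.Analysis.FluidPDE

namespace Summit.NavierStokesRegularity.NavierStokesRegularity.Theorems

namespace RigidExit

namespace ReferenceFlow

section H1

variable {ν T : ℝ} {m : EuclideanSpace ℝ (Fin 3) → EuclideanSpace ℝ (Fin 3)}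
  {v : ℝ → EuclideanSpace ℝ (Fin 3) → EuclideanSpace ℝ (Fin 3)} {q : ℝ → EuclideanSpace ℝ (Fin 3) → ℝ}

/-- Inner products of two `L²` fields on `ℝ³` are integrable (plumbing). [folklore] -/
theorem integrable_inner_of_memLp_two {f g : EuclideanSpace ℝ (Fin 3) → EuclideanSpace ℝ (Fin 3)}
    (hf : MemLp f 2 volume) (hg : MemLp g 2 volume) : Integrable (fun x => ⟪f x, g x⟫_ℝ) volume := by
  refine (hf.norm.integrable_mul hg.norm).mono' (hf.1.inner hg.1) (Eventually.of_forall fun x => ?_)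
  rw [Real.norm_eq_abs]
  simpa using abs_real_inner_le_norm (f x) (g x)

/-- The curl of a `C^∞` field with `D¹ ∈ L²` is in `L²` (plumbing). [folklore] -/
theorem memLp_two_curl {w : EuclideanSpace ℝ (Fin 3) → EuclideanSpace ℝ (Fin 3)} (hw : ContDiff ℝ (⊤ : ℕ∞) w)
    (h1 : ∫⁻ x, ‖iteratedFDeriv ℝ 1 w x‖ₑ ^ 2 < ⊤) : MemLp (curl w) 2 volume := by
  have hw1 : ContDiff ℝ 1 w := hw.of_le (by norm_cast)
  have h1' : ∫⁻ x, ‖fderiv ℝ w x‖ₑ ^ 2 < ⊤ := by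
    refine lt_of_le_of_lt (le_of_eq (lintegral_congr fun x => ?_)) h1
    rw [← ofReal_norm, ← norm_iteratedFDeriv_one (𝕜 := ℝ) (f := w), ofReal_norm]
  have m1 : MemLp (fun x => fderiv ℝ w x) 2 volume :=
    (memLp_two_iff_integrable_sq_norm (hw1.continuous_fderiv one_ne_zero).aestronglyMeasurable).2
      (integrable_sq_norm_of_lintegral_lt_top (hw1.continuous_fderiv one_ne_zero) h1')
  exact m1.of_le_mul (c := ‖curlCLM‖) (continuous_curl hw1).aestronglyMeasurable
    (Eventually.of_forall fun x => norm_curl_le w x)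

/-- `curl curl m = −Δm` of an admissible field is in `L²` (plumbing). [folklore] -/
theorem memLp_two_curl_curl (hm : ContDiff ℝ (⊤ : ℕ∞) m) (hdiv : VectorCalculus.IsDivFree m)
    (h2 : ∫⁻ x, ‖iteratedFDeriv ℝ 2 m x‖ₑ ^ 2 < ⊤) : MemLp (curl (curl m)) 2 volume := by
  have hm2 : ContDiff ℝ 2 m := hm.of_le (by norm_cast)
  have m2 : MemLp (fun x => iteratedFDeriv ℝ 2 m x) 2 volume :=
    (memLp_two_iff_integrable_sq_norm (hm.continuous_iteratedFDeriv (m := 2) (by norm_cast)).aestronglyMeasurable).2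
      (integrable_sq_norm_of_lintegral_lt_top (hm.continuous_iteratedFDeriv (m := 2) (by norm_cast)) h2)
  have mΔ : MemLp (fun x => (Δ m) x) 2 volume :=
    m2.of_le_mul (c := 3) (continuous_laplacian hm2).aestronglyMeasurable
      (Eventually.of_forall fun x => norm_laplacian_le_three_mul m x)
  have : curl (curl m) = fun x => -(Δ m) x := funext fun x => curl_curl_eq_neg_laplacian hm2 hdiv x
  rw [this]; exact mΔ.neg

/-- **Self-adjointness of the curl on the pair `(w, curl m)`**: `∫⟪curl w, curl m⟫ = ∫⟪w, curl curl m⟫` for an admissible `m`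
and a `C^∞` field `w` with `D⁰w, D¹w ∈ L²`. [folklore] -/
theorem integral_inner_curl_curl_eq {w : EuclideanSpace ℝ (Fin 3) → EuclideanSpace ℝ (Fin 3)}
    (hw : ContDiff ℝ (⊤ : ℕ∞) w) (hw0 : ∫⁻ x, ‖iteratedFDeriv ℝ 0 w x‖ₑ ^ 2 < ⊤)
    (hw1 : ∫⁻ x, ‖iteratedFDeriv ℝ 1 w x‖ₑ ^ 2 < ⊤)
    (hm : ContDiff ℝ (⊤ : ℕ∞) m) (hdiv : VectorCalculus.IsDivFree m)
    (h1 : ∫⁻ x, ‖iteratedFDeriv ℝ 1 m x‖ₑ ^ 2 < ⊤) (h2 : ∫⁻ x, ‖iteratedFDeriv ℝ 2 m x‖ₑ ^ 2 < ⊤) :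
    ∫ x, ⟪curl w x, curl m x⟫_ℝ = ∫ x, ⟪w x, curl (curl m) x⟫_ℝ := by
  have mw : MemLp w 2 volume := memLp_two_of_admissible hw hw0
  have mcw : MemLp (curl w) 2 volume := memLp_two_curl hw hw1
  have mcm : MemLp (curl m) 2 volume := memLp_two_curl hm h1
  have mccm : MemLp (curl (curl m)) 2 volume := memLp_two_curl_curl hm hdiv h2
  have hw1' : ContDiff ℝ 1 w := hw.of_le (by norm_cast)
  have hcm1 : ContDiff ℝ 1 (curl m) := contDiff_curl (n := 1) (hm.of_le (by norm_cast))
  have hX : Integrable (fun y => cross (curl m y) (w y)) := by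
    refine (mcm.norm.integrable_mul mw.norm).mono'
      ((crossCLM.continuous₂.comp ((continuous_curl (hm.of_le (by norm_cast))).prodMk hw.continuous)).aestronglyMeasurable)
      (Eventually.of_forall fun x => ?_)
    simp only [Pi.mul_apply]
    calc ‖cross (curl m x) (w x)‖
        = ‖curl m x‖ * ‖w x‖ * Real.sin (InnerProductGeometry.angle (curl m x) (w x)) := norm_cross _ _
      _ ≤ ‖curl m x‖ * ‖w x‖ * 1 := by gcongr; exact Real.sin_le_one _
      _ = ‖curl m x‖ * ‖w x‖ := mul_one _
  exact FarhatGrujic2018.integral_inner_curl_eq_integral_inner_curl_of_integrable hw1' hcm1 hX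
    (integrable_inner_of_memLp_two mw mccm) (integrable_inner_of_memLp_two mcm mcw)

/-- **The cross term converges**: along a Leray–Hopf solution `v` from an admissible `m`, `∫⟪curl v(t), curl m⟫ → ∫|curl m|²`
as `t → 0⁺` — weak `L²` continuity at `0⁺` tested against `curl curl m ∈ L²`, and self-adjointness of the curl at both ends.
[folklore] -/
theorem tendsto_integral_inner_curl_nhdsGT (hT : 0 < T) (hLH : IsLerayHopfOn T ν 0 m v)
    (hcl : IsClassicalNSSolutionOn (Ioc 0 T) ν 0 v q)
    (hB : ∀ δ : ℝ, 0 < δ → δ ≤ T → HasBoundedSobolevNormsOn (Icc δ T) v)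
    (hm : ContDiff ℝ (⊤ : ℕ∞) m ∧ VectorCalculus.IsDivFree m ∧ (∫⁻ x, ‖iteratedFDeriv ℝ 0 m x‖ₑ ^ 2 < ⊤) ∧
      (∫⁻ x, ‖iteratedFDeriv ℝ 1 m x‖ₑ ^ 2 < ⊤) ∧ (∫⁻ x, ‖iteratedFDeriv ℝ 2 m x‖ₑ ^ 2 < ⊤)) :
    Tendsto (fun t => ∫ x, ⟪curl (v t) x, curl m x⟫_ℝ) (𝓝[>] 0) (𝓝 (∫ x, ‖curl m x‖ ^ 2)) := by
  obtain ⟨hsm, hdiv, h0, h1, h2⟩ := hm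
  have mccm : MemLp (curl (curl m)) 2 volume := memLp_two_curl_curl hsm hdiv h2
  -- weak continuity at `0⁺` against `curl curl m`
  have hweak := (hLH.weak_continuous (curl (curl m)) mccm).2
  -- the limit `∫⟪m, curl curl m⟫ = ∫‖curl m‖²`
  have hlim : ∫ x, ⟪m x, curl (curl m) x⟫_ℝ = ∫ x, ‖curl m x‖ ^ 2 := by
    rw [← integral_inner_curl_curl_eq hsm h0 h1 hsm hdiv h1 h2]
    exact integral_congr_ae (Eventually.of_forall fun x => real_inner_self_eq_norm_sq _)
  rw [hlim] at hweak
  refine hweak.congr' ?_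
  filter_upwards [Ioo_mem_nhdsGT hT] with t ht
  obtain ⟨hst, -, h0t, h1t, -⟩ := slice_admissible hcl hB ⟨ht.1, ht.2.le⟩
  exact (integral_inner_curl_curl_eq hst h0t h1t hsm hdiv h1 h2).symm

/-- **The reference flow attains its datum strongly in `Ḣ¹`**: `∫|curl (v(t) − m)|² → 0` as `t → 0⁺`, for the reference flow
`(v,q)` through an admissible `m` (Leray–Hopf from `m`, `v 0 = m`, `H¹`-continuous on `[0,T]`, classical on `(0,T]`, Sobolev
norms bounded on every `[δ,T]`). [folklore] -/
theorem tendsto_enstrophy_sub_nhdsGT (hT : 0 < T) (hLH : IsLerayHopfOn T ν 0 m v) (hv0 : v 0 = m)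
    (hH1 : IsH1RegularOn (Icc 0 T) v) (hcl : IsClassicalNSSolutionOn (Ioc 0 T) ν 0 v q)
    (hB : ∀ δ : ℝ, 0 < δ → δ ≤ T → HasBoundedSobolevNormsOn (Icc δ T) v)
    (hm : ContDiff ℝ (⊤ : ℕ∞) m ∧ VectorCalculus.IsDivFree m ∧ (∫⁻ x, ‖iteratedFDeriv ℝ 0 m x‖ₑ ^ 2 < ⊤) ∧
      (∫⁻ x, ‖iteratedFDeriv ℝ 1 m x‖ₑ ^ 2 < ⊤) ∧ (∫⁻ x, ‖iteratedFDeriv ℝ 2 m x‖ₑ ^ 2 < ⊤)) :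
    Tendsto (fun t => ∫ x, ‖curl (v t - m) x‖ ^ 2) (𝓝[>] 0) (𝓝 0) := by
  have hZ := tendsto_enstrophy_nhdsGT hT hLH hv0 hH1 hcl hB hm
  have hC := tendsto_integral_inner_curl_nhdsGT hT hLH hcl hB hm
  obtain ⟨hsm, hdiv, h0, h1, h2⟩ := hm
  have mcm : MemLp (curl m) 2 volume := memLp_two_curl hsm h1
  have hIm : Integrable (fun x => ‖curl m x‖ ^ 2) := (integrable_norm_curl_sq (hsm.of_le (by norm_cast)) h1).1
  -- the expansion `∫‖curl(v t − m)‖² = Z(v t) − 2∫⟪curl v t, curl m⟫ + Z(m)` on `(0,T)`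
  have hexp : ∀ᶠ t in 𝓝[>] (0 : ℝ), ∫ x, ‖curl (v t - m) x‖ ^ 2 =
      (∫ x, ‖curl (v t) x‖ ^ 2) - 2 * (∫ x, ⟪curl (v t) x, curl m x⟫_ℝ) + ∫ x, ‖curl m x‖ ^ 2 := by
    filter_upwards [Ioo_mem_nhdsGT hT] with t ht
    obtain ⟨hst, -, h0t, h1t, -⟩ := slice_admissible hcl hB ⟨ht.1, ht.2.le⟩
    have mct : MemLp (curl (v t)) 2 volume := memLp_two_curl hst h1t
    have hIt : Integrable (fun x => ‖curl (v t) x‖ ^ 2) := (integrable_norm_curl_sq (hst.of_le (by norm_cast)) h1t).1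
    have hIi : Integrable (fun x => ⟪curl (v t) x, curl m x⟫_ℝ) := integrable_inner_of_memLp_two mct mcm
    have hdt : Differentiable ℝ (v t) := hst.differentiable (by norm_cast)
    have hdm : Differentiable ℝ m := hsm.differentiable (by norm_cast)
    have hpt : ∀ x, ‖curl (v t - m) x‖ ^ 2 = ‖curl (v t) x‖ ^ 2 - 2 * ⟪curl (v t) x, curl m x⟫_ℝ + ‖curl m x‖ ^ 2 :=
      fun x => by
      have hc : curl (v t - m) x = curl (v t) x - curl m x := by
        rw [show v t - m = fun y => v t y - m y from rfl]
        exact curl_sub (hdt x) (hdm x)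
      rw [hc, norm_sub_sq_real]
    have hI2 : Integrable (fun x => 2 * ⟪curl (v t) x, curl m x⟫_ℝ) := hIi.const_mul 2
    have hI1 : Integrable (fun x => ‖curl (v t) x‖ ^ 2 - 2 * ⟪curl (v t) x, curl m x⟫_ℝ) := hIt.sub hI2
    simp_rw [hpt]
    rw [integral_add hI1 hIm, integral_sub hIt hI2, integral_const_mul]
  have hlim : Tendsto (fun t => (∫ x, ‖curl (v t) x‖ ^ 2) - 2 * (∫ x, ⟪curl (v t) x, curl m x⟫_ℝ) + ∫ x, ‖curl m x‖ ^ 2)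
      (𝓝[>] 0) (𝓝 ((∫ x, ‖curl m x‖ ^ 2) - 2 * (∫ x, ‖curl m x‖ ^ 2) + ∫ x, ‖curl m x‖ ^ 2)) :=
    (hZ.sub (hC.const_mul 2)).add tendsto_const_nhds
  have h0' : (∫ x, ‖curl m x‖ ^ 2) - 2 * (∫ x, ‖curl m x‖ ^ 2) + ∫ x, ‖curl m x‖ ^ 2 = 0 := by ring
  rw [h0'] at hlim
  exact hlim.congr' (hexp.mono fun t ht => ht.symm)

end H1

end ReferenceFlow

end RigidExit

end Summit.NavierStokesRegularity.NavierStokesRegularity.Theorems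

end
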